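import Literature.MathematicalPhysics.QuantumLattice.BdGBondHamiltonian
import Literature.MathematicalPhysics.QuantumLattice.HubbardNNNHoppingFluxThermal
import HarnessLib

/-!
# The Paramekanti–Trivedi–Randeria gauge-function bound on the flux cost, general hopping class

Topic `Literature/MathematicalPhysics/QuantumLattice` (family `hubbard`). Everything here is PROVED
(no named fact, no definition): the model-independent form of the torus files
`HubbardNNNHoppingFluxGaugeFunction(Thermal).lean`, for the whole class of Paramekanti–Trivedi–Randeria,
PRB 57 (1998) 11639, §II — `Ĥ = −Σ t [c† c + h.c.] + V̂` on an ARBITRARY finite site set `Λ`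
(spin-½ fermions, `Orb Λ = Λ ×ₗ Fin 2`), arbitrary real bond-dependent hopping, and "`V̂` includes all
possible interactions between the particles as well as the possibly random (one-body) potential and is
an operator which is diagonal in the number basis" [PTR98, §II]. Encoding over the tree's
`bdgHopping τ = Σ_{x,y,σ} τ(x,y) c†_{xσ} c_{yσ}` (`BdGBondHamiltonian.lean`) and `Matrix.diagonal`:
hopping data `t : Λ → Λ → ℝ` symmetric (`t x y = −t^{PTR}_{xy}`, any sign, any range), bond phases
`u : Λ → Λ → ℝ` antisymmetric (the twist / inserted flux), `Φ : Finset (Orb Λ) → ℝ` ANY real function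
of the occupation configuration; `H(u) = bdgHopping (t e^{iu}) + diagonal Φ`, `H₀ = bdgHopping t + diagonal Φ`.

* Hermiticity; time reversal = entrywise conjugation reverses `u`, so `Re Z_β(H(−u)|_p) = Re Z_β(H(u)|_p)`
  on every coordinate sector `p` and `E_{N,M}(H(−u)) = E_{N,M}(H(u))` in every joint sector `(N, S^z = M)`.
* Gauge covariance with a gauge function `φ : Λ → ℝ` (PTR eq. (trial); Koma–Tasaki eq. (7)):
  `W_φᴴ H(u) W_φ = H(u + dφ)`, `(u + dφ)(x,y) = u(x,y) + φ(y) − φ(x)`, `W_φ = phaseGauge e^{iφ}`; the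
  sector partition functions of ANY operator and the sector energies are invariant.
* Midpoint identity at operator level: `H(u) + H(−u) + bdgHopping (2t(1 − cos u)) = 2 H₀`.
* **`T > 0`** (`log_partitionFn_toBlock_bdgHopping_peierls_ge_gaugeFunction`; PTR §IV "Generalization
  to finite temperatures", eq. (trial-rho); here via Peierls–Bogoliubov at `±u`): for every `β`, sector
  `p` and EVERY `φ`, `log Z_β(H₀|_p) + β Σ_{x,y,σ} t_{xy}(1 − cos(u_{xy} + φ_y − φ_x)) Re⟨(c†_{xσ}c_{yσ})|_p⟩_{β,p}
  ≤ log Z_β(H(u)|_p)`, i.e. for `β > 0`: `F_p(u) − F_p(0) ≤ Σ_{bonds b} (1 − cos(u_b + dφ_b)) K_b(β,p)`,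
  `K_b = t^{PTR}_b Σ_σ Re⟨c†_{xσ} c_{yσ} + c†_{yσ} c_{xσ}⟩_{β,p}` (an unordered bond is the two ordered pairs).
* **`T = 0`** (`minEnergyOn_szSector_bdgHopping_peierls_sub_le_gaugeFunction`; PTR §IV eqs. (trial),
  (heat), (var-bd) `D_s ≤ D_s*`, exact `1 − cos` form): for every unit ground state `ψ` of `H₀` in
  `(N, M)` and every `φ`, `E_{N,M}(H(u)) − E_{N,M}(H₀) ≤ −Σ_{x,y,σ} t_{xy}(1 − cos(u_{xy} + φ_y − φ_x)) Re⟨ψ, c†_{xσ}c_{yσ}ψ⟩`.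
Minimising over `φ` (after `1 − cos v ≤ v²/2`) is PTR's resistor network, eqs. (kirchoff)–(leg-bd) —
model-free bookkeeping, not repeated. NOT claimed: positivity of the `K_b` (PTR take `t^{PTR} > 0`; the
inequalities hold for either sign); bosons (the tree's Fock space is fermionic).

## References

* A. Paramekanti, N. Trivedi, M. Randeria, *Upper bounds on the superfluid stiffness of disordered
  systems*, Phys. Rev. B 57 (1998) 11639 (arXiv:cond-mat/9801053), §II (class `Ĥ`), §IV eqs. (trial),
  (constraint), (heat), (kirchoff), (var-bd), "Generalization to finite temperatures" eq. (trial-rho).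
  [ParamekantiTrivediRanderia1998]
* T. Koma, H. Tasaki, Phys. Rev. Lett. 68 (1992) 3248, eqs. (5), (7). [KomaTasakiPRL1992]
* N. Byers, C. N. Yang, Phys. Rev. Lett. 7 (1961) 46 (gauge classes; time reversal). [ByersYang1961]
-/

noncomputable section

namespace Literature.MathematicalPhysics.QuantumLattice

open Matrix Finset Literature.MathematicalPhysics.QuantumFieldTheory

open scoped ComplexConjugate ComplexOrder

variable {Λ : Type*} [LinearOrder Λ] [Fintype Λ]

omit [LinearOrder Λ] [Fintype Λ] in
/-- `conj (a e^{ib}) = a e^{−ib}` for real `a, b`. [folklore] -/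
private theorem conj_ofReal_mul_exp (a b : ℝ) :
    conj ((a : ℂ) * Complex.exp ((b : ℂ) * Complex.I)) =
      (a : ℂ) * Complex.exp (((-b : ℝ) : ℂ) * Complex.I) := by
  rw [map_mul, Complex.conj_ofReal, ← Complex.exp_conj, map_mul, Complex.conj_ofReal, Complex.conj_I,
    Complex.ofReal_neg, mul_neg, neg_mul]

omit [LinearOrder Λ] [Fintype Λ] in
/-- `e^{-ic} e^{id} (a e^{ib}) = a e^{i(b + d − c)}` for real `a, b, c, d` (a Peierls factor picks up
the difference of the gauge angles). [folklore] -/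
private theorem conj_circleExp_mul_circleExp_mul (a b c d : ℝ) :
    conj ((Circle.exp c : Circle) : ℂ) * ((Circle.exp d : Circle) : ℂ) *
        ((a : ℂ) * Complex.exp ((b : ℂ) * Complex.I)) =
      (a : ℂ) * Complex.exp (((b + (d - c) : ℝ) : ℂ) * Complex.I) := by
  have h : Complex.exp (((b + (d - c) : ℝ) : ℂ) * Complex.I) =
      Complex.exp ((c : ℂ) * -Complex.I) * Complex.exp ((d : ℂ) * Complex.I) *
        Complex.exp ((b : ℂ) * Complex.I) := by
    rw [← Complex.exp_add, ← Complex.exp_add]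
    congr 1
    push_cast
    ring
  rw [Circle.coe_exp, Circle.coe_exp, ← Complex.exp_conj, map_mul, Complex.conj_ofReal, Complex.conj_I, h]
  ring

omit [LinearOrder Λ] [Fintype Λ] in
/-- A unit complex number is unitary: `z̄ z = 1`. [folklore] -/
private theorem circle_star_mul_coe (z : Circle) : star (z : ℂ) * (z : ℂ) = 1 := by
  rw [Complex.star_def, ← Complex.normSq_eq_conj_mul_self, Circle.normSq_coe, Complex.ofReal_one]

/-- `H(u) = Σ_{x,y,σ} t_{xy} e^{iu_{xy}} c†_{xσ} c_{yσ} + V̂` is Hermitian for symmetric real hopping data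
`t`, antisymmetric bond phases `u` and a real occupation-diagonal `V̂` (PTR98 §II, the class `Ĥ`).
[cite: ParamekantiTrivediRanderia1998, §II] -/
theorem isHermitian_bdgHopping_peierls_add_diagonal {t u : Λ → Λ → ℝ} (ht : ∀ x y, t y x = t x y)
    (hu : ∀ x y, u y x = -u x y) (Φ : Finset (Orb Λ) → ℝ) :
    (bdgHopping (fun x y => (t x y : ℂ) * Complex.exp ((u x y : ℂ) * Complex.I)) +
      diagonal fun s => (Φ s : ℂ)).IsHermitian := by
  refine (isHermitian_bdgHopping fun x y => ?_).add ?_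
  · rw [Complex.star_def, conj_ofReal_mul_exp, ht x y, hu x y]
  · show (diagonal fun s => (Φ s : ℂ))ᴴ = diagonal fun s => (Φ s : ℂ)
    rw [diagonal_conjTranspose]
    exact congrArg diagonal (funext fun s => Complex.conj_ofReal _)

omit [Fintype Λ] in
/-- Entrywise complex conjugation of the hopping part conjugates the bond data (the Jordan–Wigner
matrices are real). [folklore] -/
private theorem bdgHopping_map_conj [Fintype Λ] (τ : Λ → Λ → ℂ) :
    (bdgHopping τ).map (starRingEnd ℂ) = bdgHopping fun x y => conj (τ x y) := by
  simp only [bdgHopping, map_conj_sum, map_conj_smul, Matrix.map_mul, creation_map_conj,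
    annihilation_map_conj]

/-- **Time reversal reverses the bond phases**: the entrywise complex conjugate (occupation basis)
of `H(u)` is `H(−u)` (real hopping data, real diagonal interaction). [cite: ByersYang1961] -/
theorem bdgHopping_peierls_add_diagonal_map_conj (t u : Λ → Λ → ℝ) (Φ : Finset (Orb Λ) → ℝ) :
    (bdgHopping (fun x y => (t x y : ℂ) * Complex.exp ((u x y : ℂ) * Complex.I)) +
        diagonal fun s => (Φ s : ℂ)).map (starRingEnd ℂ) =
      bdgHopping (fun x y => (t x y : ℂ) * Complex.exp (((-u x y : ℝ) : ℂ) * Complex.I)) +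
        diagonal fun s => (Φ s : ℂ) := by
  rw [Matrix.map_add _ (map_add _), bdgHopping_map_conj, diagonal_map (map_zero _)]
  congr 1
  · exact congrArg bdgHopping (funext fun x => funext fun y => conj_ofReal_mul_exp _ _)
  · exact congrArg diagonal (funext fun s => Complex.conj_ofReal _)

/-- **Time reversal on a coordinate sector**: `Re Z_β(H(−u)|_p) = Re Z_β(H(u)|_p)`. [cite: ByersYang1961] -/
theorem re_partitionFn_toBlock_bdgHopping_peierls_neg (t u : Λ → Λ → ℝ) (Φ : Finset (Orb Λ) → ℝ)
    (β : ℝ) (p : Finset (Orb Λ) → Prop) [Fintype {a // p a}] [DecidableEq {a // p a}] :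
    (partitionFn β ((bdgHopping (fun x y => (t x y : ℂ) * Complex.exp (((-u x y : ℝ) : ℂ) * Complex.I)) +
        diagonal fun s => (Φ s : ℂ)).toBlock p p)).re =
      (partitionFn β ((bdgHopping (fun x y => (t x y : ℂ) * Complex.exp ((u x y : ℂ) * Complex.I)) +
        diagonal fun s => (Φ s : ℂ)).toBlock p p)).re := by
  rw [← bdgHopping_peierls_add_diagonal_map_conj, toBlock_map, partitionFn_map_starRingEnd,
    Complex.conj_re]

/-- **Time reversal on a joint sector**: `E_{N,M}(H(−u)) = E_{N,M}(H(u))`. [cite: ByersYang1961] -/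
theorem minEnergyOn_szSector_bdgHopping_peierls_neg (t u : Λ → Λ → ℝ) (Φ : Finset (Orb Λ) → ℝ)
    (N : ℕ) (M : ℝ) :
    (bdgHopping (fun x y => (t x y : ℂ) * Complex.exp (((-u x y : ℝ) : ℂ) * Complex.I)) +
        diagonal fun s => (Φ s : ℂ)).minEnergyOn (szSector N M) =
      (bdgHopping (fun x y => (t x y : ℂ) * Complex.exp ((u x y : ℂ) * Complex.I)) +
        diagonal fun s => (Φ s : ℂ)).minEnergyOn (szSector N M) := by
  rw [← bdgHopping_peierls_add_diagonal_map_conj]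
  exact minEnergyOn_map_conj _ _ fun ψ h => star_mem_szSector h

/-! ### Gauge covariance with a gauge function -/

/-- Conjugation by a site-phase gauge fixes every occupation-diagonal operator. [folklore] -/
private theorem conjTranspose_phaseGauge_mul_diagonal_mul_phaseGauge (g : Λ → Circle)
    (d : Finset (Orb Λ) → ℂ) : (phaseGauge g)ᴴ * diagonal d * phaseGauge g = diagonal d := by
  ext i j
  rw [phaseGauge_eq, conjTranspose_diagonal_inst]
  simp only [mul_diagonal]
  by_cases h : i = j
  · subst h
    rw [diagonal_apply_eq, diagonal_apply_eq, mul_right_comm, circle_star_mul_coe, one_mul]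
  · rw [diagonal_apply_ne _ h, diagonal_apply_ne _ h, zero_mul, zero_mul]

/-- `W_gᴴ T(τ) W_g = T(conj(g_x) g_y τ(x,y))` (Koma–Tasaki eq. (7), inverse form of
`phaseGauge_mul_bdgHopping_mul_conjTranspose`). [cite: KomaTasakiPRL1992, eq. (7)] -/
private theorem conjTranspose_phaseGauge_mul_bdgHopping_mul_phaseGauge (g : Λ → Circle)
    (τ : Λ → Λ → ℂ) :
    (phaseGauge g)ᴴ * bdgHopping τ * phaseGauge g =
      bdgHopping fun x y => conj (g x : ℂ) * (g y : ℂ) * τ x y := by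
  have h := phaseGauge_mul_bdgHopping_mul_conjTranspose g⁻¹ τ
  rw [phaseGauge_conjTranspose, inv_inv] at h
  rw [phaseGauge_conjTranspose, h]
  congr 1
  funext x y
  simp only [Pi.inv_apply, Circle.coe_inv_eq_conj, Complex.conj_conj]

/-- **Gauge covariance with a gauge function** (PTR98 §IV eq. (trial), the trial state
`exp[iΣ_r n̂_r θ(r)]|Ψ₀⟩`; Koma–Tasaki eq. (7)): for `W_φ = phaseGauge (x ↦ e^{iφ(x)})`,
`W_φᴴ H(u) W_φ = H(u + dφ)`, `(u + dφ)(x,y) = u(x,y) + (φ(y) − φ(x))`; the interaction is untouched.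
[cite: ParamekantiTrivediRanderia1998, §IV eq. (trial)] -/
theorem conjTranspose_phaseGauge_mul_bdgHopping_peierls_add_diagonal_mul_phaseGauge
    (t u : Λ → Λ → ℝ) (Φ : Finset (Orb Λ) → ℝ) (φ : Λ → ℝ) :
    (phaseGauge fun x => Circle.exp (φ x))ᴴ *
        (bdgHopping (fun x y => (t x y : ℂ) * Complex.exp ((u x y : ℂ) * Complex.I)) +
          diagonal fun s => (Φ s : ℂ)) *
        phaseGauge (fun x => Circle.exp (φ x)) =
      bdgHopping (fun x y => (t x y : ℂ) * Complex.exp (((u x y + (φ y - φ x) : ℝ) : ℂ) * Complex.I)) +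
        diagonal fun s => (Φ s : ℂ) := by
  rw [Matrix.mul_add, Matrix.add_mul, conjTranspose_phaseGauge_mul_bdgHopping_mul_phaseGauge,
    conjTranspose_phaseGauge_mul_diagonal_mul_phaseGauge]
  congr 1
  congr 1
  funext x y
  exact conj_circleExp_mul_circleExp_mul _ _ _ _

/-- **Gauge invariance of the sector partition functions** (any operator `A`, site-phase gauge `g`,
coordinate sector `p`): `Z_β((W_gᴴ A W_g)|_p) = Z_β(A|_p)` — `W_g` is occupation-diagonal and commutes
with the compression (PTR98 §IV eq. (trial-rho)). [cite: ParamekantiTrivediRanderia1998, §IV eq. (trial-rho)] -/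
theorem partitionFn_toBlock_conjTranspose_phaseGauge_mul_mul_phaseGauge (g : Λ → Circle) (β : ℝ)
    (A : Matrix (Finset (Orb Λ)) (Finset (Orb Λ)) ℂ) (p : Finset (Orb Λ) → Prop)
    [Fintype {a // p a}] [DecidableEq {a // p a}] :
    partitionFn β (((phaseGauge g)ᴴ * A * phaseGauge g).toBlock p p) = partitionFn β (A.toBlock p p) := by
  rw [phaseGauge_eq, conjTranspose_diagonal_inst, toBlock_diagonal_mul_mul_diagonal]
  exact partitionFn_diagonal_star_mul_mul_diagonal _ (fun a => circle_star_mul_coe _) β _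

/-- **The bond currents cancel between `±u`** (PTR98 §IV eq. (heat) at operator level, exact `1 − cos`
form): `T(u) + T(−u) + Σ_{x,y,σ} 2 t_{xy} (1 − cos u_{xy}) c†_{xσ} c_{yσ} = 2 T(0)`. [cite: ParamekantiTrivediRanderia1998, §IV eq. (heat)] -/
theorem bdgHopping_peierls_add_peierls_neg_add (t u : Λ → Λ → ℝ) :
    bdgHopping (fun x y => (t x y : ℂ) * Complex.exp ((u x y : ℂ) * Complex.I)) +
        bdgHopping (fun x y => (t x y : ℂ) * Complex.exp (((-u x y : ℝ) : ℂ) * Complex.I)) +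
        bdgHopping (fun x y => ((2 * (t x y * (1 - Real.cos (u x y))) : ℝ) : ℂ)) =
      (2 : ℂ) • bdgHopping fun x y => (t x y : ℂ) := by
  rw [← bdgHopping_add, ← bdgHopping_add, ← bdgHopping_smul]
  congr 1
  funext x y
  simp only [Pi.add_apply, Pi.smul_apply, smul_eq_mul]
  push_cast
  rw [Complex.exp_mul_I, Complex.exp_mul_I, Complex.cos_neg, Complex.sin_neg]
  ring

/-- The hopping part with real weights in a fixed vector:
`Re⟨v, T(w) v⟩ = Σ_{x,y,σ} w_{xy} Re⟨v, c†_{xσ} c_{yσ} v⟩`. [folklore] -/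
private theorem re_star_dotProduct_bdgHopping_ofReal_mulVec (w : Λ → Λ → ℝ) (v : Fock (Orb Λ)) :
    (star v ⬝ᵥ (bdgHopping (fun x y => ((w x y : ℝ) : ℂ)) *ᵥ v)).re =
      ∑ x : Λ, ∑ y : Λ, ∑ σ : Fin 2,
        w x y * (star v ⬝ᵥ ((creation (orb x σ) * annihilation (orb y σ)) *ᵥ v)).re := by
  simp only [bdgHopping, Matrix.sum_mulVec, smul_mulVec, dotProduct_sum, dotProduct_smul, smul_eq_mul,
    Complex.re_sum, Complex.re_ofReal_mul]

/-- The hopping part with real weights in the Gibbs state of a block Hamiltonian `B` on a sector: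
`Re⟨T(w)|_p⟩ = Σ_{x,y,σ} w_{xy} Re⟨(c†_{xσ} c_{yσ})|_p⟩`. [folklore] -/
private theorem re_gibbsState_toBlock_bdgHopping_ofReal (w : Λ → Λ → ℝ) (β : ℝ)
    (p : Finset (Orb Λ) → Prop) [Fintype {a // p a}] [DecidableEq {a // p a}]
    (B : Matrix {a // p a} {a // p a} ℂ) :
    (gibbsState β B ((bdgHopping (fun x y => ((w x y : ℝ) : ℂ))).toBlock p p)).re =
      ∑ x : Λ, ∑ y : Λ, ∑ σ : Fin 2,
        w x y * (gibbsState β B ((creation (orb x σ) * annihilation (orb y σ)).toBlock p p)).re := by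
  have h : (bdgHopping (fun x y => ((w x y : ℝ) : ℂ))).toBlock p p =
      ∑ x : Λ, ∑ y : Λ, ∑ σ : Fin 2,
        ((w x y : ℝ) : ℂ) • (creation (orb x σ) * annihilation (orb y σ)).toBlock p p := by
    ext a b
    simp only [bdgHopping, toBlock_apply, Matrix.sum_apply, Matrix.smul_apply, smul_eq_mul]
  rw [h]
  simp only [map_sum, map_smul, smul_eq_mul, Complex.re_sum, Complex.re_ofReal_mul]

/-! ### `T > 0`: the gauge-function bound on the flux cost of the sector free energy -/

/-- **Flux cost of the sector free energy, arbitrary bond phases** (Peierls–Bogoliubov at `±u`, time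
reversal, midpoint identity): `log Z_β(H₀|_p) + β Σ_{x,y,σ} t_{xy} (1 − cos u_{xy}) Re⟨(c†_{xσ} c_{yσ})|_p⟩_{β,p}
≤ log Z_β(H(u)|_p)` (`⟨·⟩_{β,p}` the Gibbs state of `H₀|_p`). [cite: ParamekantiTrivediRanderia1998, §IV eqs. (heat), (trial-rho)] -/
theorem log_partitionFn_toBlock_bdgHopping_peierls_ge {t u : Λ → Λ → ℝ} (ht : ∀ x y, t y x = t x y)
    (hu : ∀ x y, u y x = -u x y) (Φ : Finset (Orb Λ) → ℝ) (β : ℝ) (p : Finset (Orb Λ) → Prop)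
    [Fintype {a // p a}] [DecidableEq {a // p a}] :
    Real.log (partitionFn β ((bdgHopping (fun x y => (t x y : ℂ)) + diagonal fun s => (Φ s : ℂ)).toBlock p p)).re +
        β * ∑ x : Λ, ∑ y : Λ, ∑ σ : Fin 2, t x y * (1 - Real.cos (u x y)) *
          (gibbsState β ((bdgHopping (fun x y => (t x y : ℂ)) + diagonal fun s => (Φ s : ℂ)).toBlock p p)
            ((creation (orb x σ) * annihilation (orb y σ)).toBlock p p)).re ≤
      Real.log (partitionFn β ((bdgHopping (fun x y => (t x y : ℂ) * Complex.exp ((u x y : ℂ) * Complex.I)) +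
        diagonal fun s => (Φ s : ℂ)).toBlock p p)).re := by
  rcases isEmpty_or_nonempty {a // p a} with hp | hp
  · simp [partitionFn, Matrix.trace, gibbsState_apply]
  have hu' : ∀ x y, -u y x = -(-u x y) := fun x y => by rw [hu x y]
  have h0 : ((bdgHopping fun x y => (t x y : ℂ)) + diagonal fun s => (Φ s : ℂ)) =
      bdgHopping (fun x y => (t x y : ℂ) * Complex.exp (((0 : Λ → Λ → ℝ) x y : ℂ) * Complex.I)) +
        diagonal fun s => (Φ s : ℂ) := by simp
  set H₀ := (bdgHopping fun x y => (t x y : ℂ)) + diagonal fun s => (Φ s : ℂ) with hH₀def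
  set Hp := bdgHopping (fun x y => (t x y : ℂ) * Complex.exp ((u x y : ℂ) * Complex.I)) +
    diagonal fun s => (Φ s : ℂ) with hHpdef
  set Hm := bdgHopping (fun x y => (t x y : ℂ) * Complex.exp (((-u x y : ℝ) : ℂ) * Complex.I)) +
    diagonal fun s => (Φ s : ℂ) with hHmdef
  have hH₀ : H₀.IsHermitian := by
    rw [h0]; exact isHermitian_bdgHopping_peierls_add_diagonal ht (fun _ _ => by simp) Φ
  set B₀ := H₀.toBlock p p with hB₀def
  have hB₀ : B₀.IsHermitian := hH₀.submatrix _
  have hWp : (Hp.toBlock p p - B₀).IsHermitian :=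
    ((isHermitian_bdgHopping_peierls_add_diagonal ht hu Φ).submatrix _).sub hB₀
  have hWm : (Hm.toBlock p p - B₀).IsHermitian :=
    ((isHermitian_bdgHopping_peierls_add_diagonal ht hu' Φ).submatrix _).sub hB₀
  -- Peierls–Bogoliubov at the untwisted block, for `+u` and `-u`
  have hPB1 := log_partitionFn_sub_le_log_partitionFn_add hB₀ hWp β
  have hPB2 := log_partitionFn_sub_le_log_partitionFn_add hB₀ hWm β
  rw [add_sub_cancel] at hPB1 hPB2
  -- time reversal
  rw [hHmdef, re_partitionFn_toBlock_bdgHopping_peierls_neg, ← hHpdef] at hPB2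
  -- the midpoint identity, compressed to the sector and evaluated in the Gibbs state
  have hmid := bdgHopping_peierls_add_peierls_neg_add t u
  have hblock : Hp.toBlock p p - B₀ + (Hm.toBlock p p - B₀) =
      -(bdgHopping (fun x y => ((2 * (t x y * (1 - Real.cos (u x y))) : ℝ) : ℂ))).toBlock p p := by
    ext a b
    have hab := congrFun (congrFun hmid a) b
    simp only [Matrix.add_apply, Matrix.smul_apply, smul_eq_mul] at hab
    simp only [hHpdef, hHmdef, hB₀def, hH₀def, toBlock_apply, Matrix.add_apply, Matrix.sub_apply,
      Matrix.neg_apply]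
    linear_combination hab
  have hsum : (gibbsState β B₀ (Hp.toBlock p p - B₀)).re + (gibbsState β B₀ (Hm.toBlock p p - B₀)).re =
      -(2 * ∑ x : Λ, ∑ y : Λ, ∑ σ : Fin 2, t x y * (1 - Real.cos (u x y)) *
        (gibbsState β B₀ ((creation (orb x σ) * annihilation (orb y σ)).toBlock p p)).re) := by
    rw [← Complex.add_re, ← map_add, hblock, map_neg, Complex.neg_re,
      re_gibbsState_toBlock_bdgHopping_ofReal]
    simp only [Finset.mul_sum, mul_assoc]
  have hkey := congrArg (fun z : ℝ => β * z) hsum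
  simp only [mul_add] at hkey
  linarith

/-- **The Paramekanti–Trivedi–Randeria gauge-function bound at `T > 0`, general class** (PRB 57 (1998)
11639, §IV "Generalization to finite temperatures": the trial density matrix `e^{iΣ n̂_r θ(r)} ρ̂₀ e^{−iΣ n̂_r θ(r)}`
keeps the entropy of `ρ̂₀`): for every finite site set, symmetric real hopping `t`, antisymmetric bond
phases `u`, real occupation-diagonal `Φ`, every `β`, coordinate sector `p` and EVERY gauge function `φ`,
`log Z_β(H₀|_p) + β Σ_{x,y,σ} t_{xy} (1 − cos(u_{xy} + φ_y − φ_x)) Re⟨(c†_{xσ} c_{yσ})|_p⟩_{β,p} ≤ log Z_β(H(u)|_p)`;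
for `β > 0`: `F_p(u) − F_p(0) ≤ Σ_b (1 − cos(u_b + dφ_b)) K_b(β,p)`. [cite: ParamekantiTrivediRanderia1998, §IV eqs. (heat), (var-bd), (trial-rho)] -/
theorem log_partitionFn_toBlock_bdgHopping_peierls_ge_gaugeFunction {t u : Λ → Λ → ℝ}
    (ht : ∀ x y, t y x = t x y) (hu : ∀ x y, u y x = -u x y) (Φ : Finset (Orb Λ) → ℝ) (β : ℝ)
    (p : Finset (Orb Λ) → Prop) [Fintype {a // p a}] [DecidableEq {a // p a}] (φ : Λ → ℝ) :
    Real.log (partitionFn β ((bdgHopping (fun x y => (t x y : ℂ)) + diagonal fun s => (Φ s : ℂ)).toBlock p p)).re +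
        β * ∑ x : Λ, ∑ y : Λ, ∑ σ : Fin 2, t x y * (1 - Real.cos (u x y + (φ y - φ x))) *
          (gibbsState β ((bdgHopping (fun x y => (t x y : ℂ)) + diagonal fun s => (Φ s : ℂ)).toBlock p p)
            ((creation (orb x σ) * annihilation (orb y σ)).toBlock p p)).re ≤
      Real.log (partitionFn β ((bdgHopping (fun x y => (t x y : ℂ) * Complex.exp ((u x y : ℂ) * Complex.I)) +
        diagonal fun s => (Φ s : ℂ)).toBlock p p)).re := by
  have hu' : ∀ x y, u y x + (φ x - φ y) = -(u x y + (φ y - φ x)) := fun x y => by rw [hu x y]; ring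
  have h := log_partitionFn_toBlock_bdgHopping_peierls_ge (u := fun x y => u x y + (φ y - φ x)) ht hu' Φ β p
  rwa [← conjTranspose_phaseGauge_mul_bdgHopping_peierls_add_diagonal_mul_phaseGauge t u Φ φ,
    partitionFn_toBlock_conjTranspose_phaseGauge_mul_mul_phaseGauge] at h

/-! ### `T = 0`: the gauge-function bound on the flux cost of the sector energies -/

/-- **Flux cost of a sector ground-state energy, arbitrary bond phases**: for every unit ground state
`ψ` of `H₀` in `(N, S^z = M)`, `E_{N,M}(H(u)) − E_{N,M}(H₀) ≤ −Σ_{x,y,σ} t_{xy} (1 − cos u_{xy}) Re⟨ψ, c†_{xσ} c_{yσ} ψ⟩`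
(price `ψ` in `H(±u)`, `E(−u) = E(u)`, currents cancel). [cite: ParamekantiTrivediRanderia1998, §IV eqs. (heat)–(var-bd)] -/
theorem minEnergyOn_szSector_bdgHopping_peierls_sub_le {t u : Λ → Λ → ℝ} (ht : ∀ x y, t y x = t x y)
    (hu : ∀ x y, u y x = -u x y) (Φ : Finset (Orb Λ) → ℝ) (N : ℕ) (M : ℝ) {ψ : Fock (Orb Λ)}
    (hgs : IsGroundStateInSector ((bdgHopping fun x y => (t x y : ℂ)) + diagonal fun s => (Φ s : ℂ)) N M ψ)
    (h1 : star ψ ⬝ᵥ ψ = 1) :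
    (bdgHopping (fun x y => (t x y : ℂ) * Complex.exp ((u x y : ℂ) * Complex.I)) +
          diagonal fun s => (Φ s : ℂ)).minEnergyOn (szSector N M) -
        ((bdgHopping fun x y => (t x y : ℂ)) + diagonal fun s => (Φ s : ℂ)).minEnergyOn (szSector N M) ≤
      -∑ x : Λ, ∑ y : Λ, ∑ σ : Fin 2, t x y * (1 - Real.cos (u x y)) *
        (star ψ ⬝ᵥ ((creation (orb x σ) * annihilation (orb y σ)) *ᵥ ψ)).re := by
  have hu' : ∀ x y, -u y x = -(-u x y) := fun x y => by rw [hu x y]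
  -- the interaction contributes the same amount to every expectation below
  have hsplit : ∀ τ : Λ → Λ → ℂ, (star ψ ⬝ᵥ ((bdgHopping τ + diagonal fun s => (Φ s : ℂ)) *ᵥ ψ)).re =
      (star ψ ⬝ᵥ (bdgHopping τ *ᵥ ψ)).re + (star ψ ⬝ᵥ ((diagonal fun s => (Φ s : ℂ)) *ᵥ ψ)).re := by
    intro τ
    rw [add_mulVec, dotProduct_add, Complex.add_re]
  -- price the ground state in `H(u)` and in `H(-u)`; `E(-u) = E(u)`
  have hp := minEnergyOn_le_rayleigh_of_mem (isHermitian_bdgHopping_peierls_add_diagonal ht hu Φ) _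
    hgs.1 h1
  have hm := minEnergyOn_le_rayleigh_of_mem (isHermitian_bdgHopping_peierls_add_diagonal ht hu' Φ) _
    hgs.1 h1
  rw [minEnergyOn_szSector_bdgHopping_peierls_neg, hsplit] at hm
  rw [hsplit] at hp
  -- the ground-state energy is the expectation
  have hE : (star ψ ⬝ᵥ (bdgHopping (fun x y => (t x y : ℂ)) *ᵥ ψ)).re +
      (star ψ ⬝ᵥ ((diagonal fun s => (Φ s : ℂ)) *ᵥ ψ)).re =
        ((bdgHopping fun x y => (t x y : ℂ)) + diagonal fun s => (Φ s : ℂ)).minEnergyOn (szSector N M) := by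
    rw [← hsplit, hgs.2.2, dotProduct_smul, h1, smul_eq_mul, mul_one, Complex.ofReal_re]
  -- the midpoint identity in the vector `ψ`
  have hmid := congrArg (fun A : Matrix (Finset (Orb Λ)) (Finset (Orb Λ)) ℂ => (star ψ ⬝ᵥ (A *ᵥ ψ)).re)
    (bdgHopping_peierls_add_peierls_neg_add t u)
  simp only [add_mulVec, dotProduct_add, Complex.add_re, smul_mulVec, dotProduct_smul, smul_eq_mul,
    re_star_dotProduct_bdgHopping_ofReal_mulVec] at hmid
  have h2re : ((2 : ℂ) * (star ψ ⬝ᵥ (bdgHopping (fun x y => (t x y : ℂ)) *ᵥ ψ))).re =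
      2 * (star ψ ⬝ᵥ (bdgHopping (fun x y => (t x y : ℂ)) *ᵥ ψ)).re := by
    simp [Complex.mul_re]
  have hS : ∑ x : Λ, ∑ y : Λ, ∑ σ : Fin 2, 2 * (t x y * (1 - Real.cos (u x y))) *
        (star ψ ⬝ᵥ ((creation (orb x σ) * annihilation (orb y σ)) *ᵥ ψ)).re =
      2 * ∑ x : Λ, ∑ y : Λ, ∑ σ : Fin 2, t x y * (1 - Real.cos (u x y)) *
        (star ψ ⬝ᵥ ((creation (orb x σ) * annihilation (orb y σ)) *ᵥ ψ)).re := by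
    simp only [Finset.mul_sum, mul_assoc]
  rw [h2re, hS] at hmid
  linarith

/-- **The Paramekanti–Trivedi–Randeria gauge-function bound at `T = 0`, general class** (PRB 57 (1998)
11639, §IV eqs. (trial), (heat), (var-bd) `D_s ≤ D_s*`, exact `1 − cos` form): for every unit ground state
`ψ` of `H₀` in the joint sector `(N, M)` and EVERY gauge function `φ`,
`E_{N,M}(H(u)) − E_{N,M}(H₀) ≤ −Σ_{x,y,σ} t_{xy} (1 − cos(u_{xy} + φ_y − φ_x)) Re⟨ψ, c†_{xσ} c_{yσ} ψ⟩ = Σ_b (1 − cos(u_b + dφ_b)) K_b(ψ)`,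
`K_b = t^{PTR}_b Σ_σ Re⟨c†_{xσ} c_{yσ} + c†_{yσ} c_{xσ}⟩_ψ`; minimising over `φ` (after `1 − cos v ≤ v²/2`) is the resistor
network of eqs. (kirchoff)–(leg-bd). [cite: ParamekantiTrivediRanderia1998, §IV eqs. (trial)–(var-bd)] -/
theorem minEnergyOn_szSector_bdgHopping_peierls_sub_le_gaugeFunction {t u : Λ → Λ → ℝ}
    (ht : ∀ x y, t y x = t x y) (hu : ∀ x y, u y x = -u x y) (Φ : Finset (Orb Λ) → ℝ) (N : ℕ)
    (M : ℝ) {ψ : Fock (Orb Λ)}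
    (hgs : IsGroundStateInSector ((bdgHopping fun x y => (t x y : ℂ)) + diagonal fun s => (Φ s : ℂ)) N M ψ)
    (h1 : star ψ ⬝ᵥ ψ = 1) (φ : Λ → ℝ) :
    (bdgHopping (fun x y => (t x y : ℂ) * Complex.exp ((u x y : ℂ) * Complex.I)) +
          diagonal fun s => (Φ s : ℂ)).minEnergyOn (szSector N M) -
        ((bdgHopping fun x y => (t x y : ℂ)) + diagonal fun s => (Φ s : ℂ)).minEnergyOn (szSector N M) ≤
      -∑ x : Λ, ∑ y : Λ, ∑ σ : Fin 2, t x y * (1 - Real.cos (u x y + (φ y - φ x))) *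
        (star ψ ⬝ᵥ ((creation (orb x σ) * annihilation (orb y σ)) *ᵥ ψ)).re := by
  have hu' : ∀ x y, u y x + (φ x - φ y) = -(u x y + (φ y - φ x)) := fun x y => by rw [hu x y]; ring
  have h := minEnergyOn_szSector_bdgHopping_peierls_sub_le (u := fun x y => u x y + (φ y - φ x))
    ht hu' Φ N M hgs h1
  rwa [← conjTranspose_phaseGauge_mul_bdgHopping_peierls_add_diagonal_mul_phaseGauge t u Φ φ,
    minEnergyOn_szSector_phaseGauge_conj] at h

end Literature.MathematicalPhysics.QuantumLattice

end
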